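import Mathlib.Algebra.Polynomial.Bivariate
import Literature.NumberTheory.EllipticCurves.DivisionPolynomialTorsion
import Literature.NumberTheory.EllipticCurves.IsogenyHom
import HarnessLib

/-!
# `Hom_K(E, E')` is a group: proof of the named fact `mem_homModule_iff`

Sibling file of `Literature.NumberTheory.EllipticCurves.IsogenyHom` (D-0014 append protocol):
it discharges the named fact `WeierstrassCurve.mem_homModule_iff W W'` — for elliptic curves
`E, E'` over `K`, an additive map `E(K̄) → E'(K̄)` lies in the `ℤ`-span `homModule W W'` of the
isogenies over `K` iff it is `0` or an isogeny over `K` (Silverman, *AEC*, III.§4: "(III.3.6)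
implies that `φ + ψ` is a morphism, so it is an isogeny. Hence `Hom(E₁, E₂)` is a group") — in
the encoding of the prelude `Isogeny` (an isogeny is an additive map on `K̄`-points agreeing with a
`K̄`-rational map off a finite set, `Γ_K`-equivariant, with finite kernel).

## Contents

* `WeierstrassCurve.geomPoints.xy`: the affine coordinates of a geometric point (junk `0` at `O`);
  `agreesWithRationalMapAt_iff` unfolds the prelude's `AgreesWithRationalMapAt` through it;
  `IsAlgebraicOn.finite_ker`: an algebraic additive map has finite kernel (its values off the
  exceptional set are affine points).
* `WeierstrassCurve.geomPoints.instInfinite`: `E(K̄)` is infinite for `E` elliptic (the tree's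
  `WeierstrassCurve.infinite_point` of `DivisionPolynomialTorsion` on the synonym `geomPoints`).
* `WeierstrassCurve.eval_eq_zero_of_infinite_zeros` (**finitely many zeros**): a polynomial
  `g ∈ K̄[x, y]` vanishing at infinitely many points of `E(K̄)` vanishes on the whole affine curve
  — a corollary of the tree's `WeierstrassCurve.finite_setOf_evalEval_eq_zero`
  (`DivisionPolynomialTorsion`; norm to `K̄[x]`) through the dictionary
  `eval_eq_evalEval_equivMvPolynomial_symm` between `MvPolynomial (Fin 2)` (the prelude's
  polynomials) and Mathlib's `K̄[X][Y]`.
* `Literature.NumberTheory.EllipticCurves.RatFrac`: formal fractions of two-variable polynomials with the predicate `HasValue` and its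
  calculus (`const`, `add`, `neg`, `sub`, `mul`, `div`, `congr`), used to write down the rational
  maps of the group-law algorithm; `Literature.NumberTheory.EllipticCurves.AddMonoidHom.eq_of_eqOn_compl_finite`: additive maps
  agreeing off a finite subset of an infinite group are equal (from the tree's
  `Literature.NumberTheory.EllipticCurves.AddSubgroup.eq_top_of_finite_compl`).
* `WeierstrassCurve.IsAlgebraicOn.neg`, `WeierstrassCurve.isAlgebraicOn_add_of_finite` (chord),
  `WeierstrassCurve.isAlgebraicOn_two_mul_of_finite` (tangent): the group-law formulas
  (Silverman, *AEC*, III.2.3) applied to rational maps.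
* `WeierstrassCurve.Isogeny.add_toAddMonoidHom_eq_zero_or_isAlgebraicOn`,
  `WeierstrassCurve.Isogeny.add_toAddMonoidHom_eq_zero_or_exists`,
  `WeierstrassCurve.Isogeny.exists_toAddMonoidHom_eq_neg`: sums and negatives of isogenies over
  `K` are isogenies over `K` or zero.
* `WeierstrassCurve.mem_homModule_iff_holds : mem_homModule_iff W W'`.

## The argument for `φ + ψ`

Let `φ, ψ` agree with `(P₁/Q₁, P₂/Q₂)`, `(P₁'/Q₁', P₂'/Q₂')` off a finite set `S`. If
`x(φP) ≠ x(ψP)` (i.e. `(P₁Q₁' - P₁'Q₁)(P) ≠ 0`) for all but finitely many `P`, the chord formula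
gives `φ + ψ` as a rational map off a finite set. Otherwise `P₁Q₁' - P₁'Q₁` vanishes at infinitely
many points of `E(K̄)`, hence on the whole curve, so `x(φP) = x(ψP)` and `φP = ±ψP` for every
`P ∉ S`. Comparing `y`-coordinates through `P₂Q₂' - P₂'Q₂` in the same way: either `φP ≠ ψP`, so
`φP = -ψP`, off a finite set, and then `φ + ψ = 0` (additive maps agreeing off a finite subset of
the infinite group `E(K̄)` agree); or `φ = ψ` off `S`, hence `φ = ψ`, and `φ + φ` is given by the
tangent formula off the points where `2y + a₁x + a₃` vanishes at `φP` — finitely many, or else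
(finitely many zeros again) `2φP = O` for all `P ∉ S` and `φ + φ = 0`. No appeal to Silverman's
II.2.1/III.4.8 (extension of rational maps to morphisms) is needed: only the group-law algorithm
and the finiteness of zeros of a non-zero element of the coordinate ring.

## References

* [SilvermanAEC2009] J. H. Silverman, *The Arithmetic of Elliptic Curves*, 2nd ed., GTM 106,
  Springer 2009: III.§4 (the group `Hom(E₁, E₂)`, before Example III.4.1), III.2.3 (group law
  algorithm), II.§1–2 (zeros of functions on curves).

## Design choices

* `noncomputable section`, `open scoped Classical`, `K : Type u` as in the preludes; curve-specific
  declarations are dot-notation extensions in `namespace WeierstrassCurve`, generic ones live in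
  `namespace Literature`.
* `RatFrac` is a bare pair (no quotient, no normalisation): only the evaluation predicate
  `HasValue` matters, and it is stated multiplicatively (`num(v) = a · den(v)`, `den(v) ≠ 0`).
* Reuse (review of p6183): infinitude of points, finiteness of zeros and "finite complement ⇒
  whole group" come from `DivisionPolynomialTorsion` (`infinite_point`,
  `finite_setOf_evalEval_eq_zero`, `Literature.NumberTheory.EllipticCurves.AddSubgroup.eq_top_of_finite_compl`,
  `instIsEllipticBaseChange`); only their `geomPoints`/`MvPolynomial` readings are added here.
-/

noncomputable section

open scoped Classical
open scoped Polynomial.Bivariate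
open Polynomial

universe u

namespace WeierstrassCurve

variable {K : Type u} [Field K] {W W' : WeierstrassCurve K}

namespace geomPoints

/-- The affine coordinates `(x, y)` of a geometric point, as a function `Fin 2 → K̄` (so that
two-variable polynomials can be evaluated at it with `MvPolynomial.eval`); the point at infinity
is sent to `(0, 0)` (a junk value). [folklore] -/
def xy : W.geomPoints → Fin 2 → AlgebraicClosure K :=
  fun P ↦ match (P : (W.baseChange (AlgebraicClosure K)).toAffine.Point) with
    | .zero => 0
    | .some x y _ => ![x, y]

/-- The coordinates of `O` are the junk value `0`. [folklore] -/
@[simp] theorem xy_zero : xy (0 : W.geomPoints) = 0 := rfl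

/-- The coordinates of the affine point `(x, y)`. [folklore] -/
@[simp] theorem xy_some {x y : AlgebraicClosure K}
    (h : (W.baseChange (AlgebraicClosure K)).toAffine.Nonsingular x y) :
    xy (Affine.Point.some x y h : W.geomPoints) = ![x, y] := rfl

/-- Two affine geometric points with the same coordinates are equal. [folklore] -/
theorem eq_of_xy_eq {P Q : W.geomPoints} (hP : P ≠ 0) (hQ : Q ≠ 0) (h : xy P = xy Q) : P = Q := by
  cases P with
  | zero => exact (hP rfl).elim
  | some x₁ y₁ h₁ =>
    cases Q with
    | zero => exact (hQ rfl).elim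
    | some x₂ y₂ h₂ =>
      simp only [xy_some] at h
      have hx : x₁ = x₂ := by simpa using congrFun h 0
      have hy : y₁ = y₂ := by simpa using congrFun h 1
      subst hx hy
      rfl

end geomPoints

open _root_.WeierstrassCurve.geomPoints

/-- Unfolding `AgreesWithRationalMapAt` in terms of the coordinate function `geomPoints.xy`:
`φ` agrees with `(P₁/Q₁, P₂/Q₂)` at `P` iff `P` is affine, `Q₁(P) ≠ 0`, `Q₂(P) ≠ 0` and `φ P` is
the affine point `(P₁(P)/Q₁(P), P₂(P)/Q₂(P))`. [folklore] -/
theorem agreesWithRationalMapAt_iff {P₁ Q₁ P₂ Q₂ : MvPolynomial (Fin 2) (AlgebraicClosure K)}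
    {φ : W.geomPoints → W'.geomPoints} {P : W.geomPoints} :
    AgreesWithRationalMapAt W W' P₁ Q₁ P₂ Q₂ φ P ↔
      P ≠ 0 ∧ MvPolynomial.eval (xy P) Q₁ ≠ 0 ∧ MvPolynomial.eval (xy P) Q₂ ≠ 0 ∧
        ∃ h' : (W'.baseChange (AlgebraicClosure K)).toAffine.Nonsingular
            (MvPolynomial.eval (xy P) P₁ / MvPolynomial.eval (xy P) Q₁)
            (MvPolynomial.eval (xy P) P₂ / MvPolynomial.eval (xy P) Q₂),
          φ P = (Affine.Point.some _ _ h' : W'.geomPoints) := by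
  constructor
  · rintro ⟨x, y, h, rfl, hQ₁, hQ₂, h', hφ⟩
    exact ⟨Affine.Point.some_ne_zero h, hQ₁, hQ₂, h', hφ⟩
  · rintro ⟨hP, hQ₁, hQ₂, h', hφ⟩
    cases P with
    | zero => exact (hP rfl).elim
    | some x y h => exact ⟨x, y, h, rfl, hQ₁, hQ₂, h', hφ⟩

/-- Where `φ` agrees with a rational map, its value is an affine point, hence non-zero.
[folklore] -/
theorem AgreesWithRationalMapAt.apply_ne_zero
    {P₁ Q₁ P₂ Q₂ : MvPolynomial (Fin 2) (AlgebraicClosure K)}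
    {φ : W.geomPoints → W'.geomPoints} {P : W.geomPoints}
    (h : AgreesWithRationalMapAt W W' P₁ Q₁ P₂ Q₂ φ P) : φ P ≠ 0 := by
  obtain ⟨-, -, -, h', hφ⟩ := agreesWithRationalMapAt_iff.mp h
  rw [hφ]
  exact Affine.Point.some_ne_zero h'

/-- An additive map which is algebraic (agrees with a rational map off a finite set) has finite
kernel: off the exceptional set its values are affine points. [folklore] -/
theorem IsAlgebraicOn.finite_ker {f : W.geomPoints →+ W'.geomPoints} (hf : IsAlgebraicOn W W' f) :
    (f.ker : Set W.geomPoints).Finite := by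
  obtain ⟨P₁, Q₁, P₂, Q₂, hfin⟩ := hf
  refine hfin.subset fun P hP hA ↦ ?_
  exact hA.apply_ne_zero (f.mem_ker.mp hP)

/-! ## `E(K̄)` is infinite -/

variable (W) in
/-- `E(K̄)` is infinite for `E` elliptic: the tree's `WeierstrassCurve.infinite_point`
(`DivisionPolynomialTorsion`) for `W / K̄`, read on the type synonym `geomPoints W`. [folklore] -/
instance geomPoints.instInfinite [W.IsElliptic] : Infinite W.geomPoints :=
  infinite_point (W.baseChange (AlgebraicClosure K))

/-! ## A polynomial vanishing at infinitely many points of `E(K̄)` vanishes on the affine curve -/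

section Zeros

/-- Evaluating a two-variable polynomial at `(x, y)` is evaluating the corresponding bivariate
polynomial of `K̄[X][Y]` (Mathlib `Polynomial.Bivariate.equivMvPolynomial`). [folklore] -/
theorem eval_eq_evalEval_equivMvPolynomial_symm {F : Type*} [CommRing F]
    (g : MvPolynomial (Fin 2) F) (x y : F) :
    MvPolynomial.eval ![x, y] g =
      ((Polynomial.Bivariate.equivMvPolynomial F).symm g).evalEval x y := by
  have key : (MvPolynomial.aeval ![x, y] : MvPolynomial (Fin 2) F →ₐ[F] F) =
      (Polynomial.aevalAeval x y).comp
        ((Polynomial.Bivariate.equivMvPolynomial F).symm :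
          MvPolynomial (Fin 2) F →ₐ[F] F[X][Y]) := by
    refine MvPolynomial.algHom_ext fun i ↦ ?_
    fin_cases i <;> simp
  have h : (MvPolynomial.aeval ![x, y] : MvPolynomial (Fin 2) F →ₐ[F] F) g =
      Polynomial.aevalAeval x y ((Polynomial.Bivariate.equivMvPolynomial F).symm g) := by
    rw [key]; rfl
  rw [Polynomial.coe_aevalAeval_eq_evalEval] at h
  rw [← h]
  rfl

/-- **Finitely many zeros.** If a polynomial `g ∈ K̄[x, y]` vanishes at infinitely many points of
`E(K̄)`, then it vanishes at every point of the affine curve: either `g ≡ 0` modulo the Weierstrass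
polynomial, or its zero set on `E(K̄)` is finite by the tree's
`WeierstrassCurve.finite_setOf_evalEval_eq_zero` (`DivisionPolynomialTorsion`: the norm of
`g ≡ p + qy` to `K̄[x]` is non-zero and vanishes at the abscissa of every zero). Silverman, *AEC*,
II.§1–2 (a non-zero function has finitely many zeros). [folklore] -/
theorem eval_eq_zero_of_infinite_zeros {g : MvPolynomial (Fin 2) (AlgebraicClosure K)}
    (hg : {P : W.geomPoints | P ≠ 0 ∧ MvPolynomial.eval (xy P) g = 0}.Infinite)
    {x y : AlgebraicClosure K} (hxy : (W.baseChange (AlgebraicClosure K)).toAffine.Equation x y) :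
    MvPolynomial.eval ![x, y] g = 0 := by
  set g₂ : (AlgebraicClosure K)[X][Y] :=
    (Polynomial.Bivariate.equivMvPolynomial (AlgebraicClosure K)).symm g with hg₂
  by_cases h0 : Affine.CoordinateRing.mk (W.baseChange (AlgebraicClosure K)) g₂ = 0
  · obtain ⟨r, hr⟩ := AdjoinRoot.mk_eq_zero.mp h0
    have hxy' : (W.baseChange (AlgebraicClosure K)).toAffine.polynomial.evalEval x y = 0 := hxy
    rw [eval_eq_evalEval_equivMvPolynomial_symm, ← hg₂, hr, evalEval_mul, hxy', zero_mul]
  · exfalso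
    refine hg ((finite_setOf_evalEval_eq_zero (W.baseChange (AlgebraicClosure K)) h0).subset ?_)
    rintro P ⟨hP0, hPg⟩
    cases P with
    | zero => exact (hP0 rfl).elim
    | some x' y' h' =>
      rw [xy_some, eval_eq_evalEval_equivMvPolynomial_symm] at hPg
      exact ⟨x', y', h', rfl, hPg⟩

end Zeros

end WeierstrassCurve

/-! ## Formal fractions of two-variable polynomials and their values -/

namespace Literature.NumberTheory.EllipticCurves

/-- A formal fraction `num / den` of two-variable polynomials over `F` (no quotienting: a mere
pair, used to build the rational maps witnessing `IsAlgebraicOn` for `-φ`, `φ + ψ`, `φ + φ`).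
[folklore] -/
structure RatFrac (F : Type*) [CommRing F] where
  /-- The numerator. -/
  num : MvPolynomial (Fin 2) F
  /-- The denominator. -/
  den : MvPolynomial (Fin 2) F

namespace RatFrac

variable {F : Type*} [Field F]

/-- `f.HasValue v a`: at the point `v = (x, y)` the denominator of `f` does not vanish and the
fraction evaluates to `a` (stated multiplicatively: `num(v) = a · den(v)`). [folklore] -/
def HasValue (f : RatFrac F) (v : Fin 2 → F) (a : F) : Prop :=
  MvPolynomial.eval v f.den ≠ 0 ∧ MvPolynomial.eval v f.num = a * MvPolynomial.eval v f.den

/-- The constant fraction `c / 1`. [folklore] -/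
def const (c : F) : RatFrac F := ⟨MvPolynomial.C c, 1⟩

/-- Sum of formal fractions. [folklore] -/
def add (f g : RatFrac F) : RatFrac F := ⟨f.num * g.den + g.num * f.den, f.den * g.den⟩

/-- Negative of a formal fraction. [folklore] -/
def neg (f : RatFrac F) : RatFrac F := ⟨-f.num, f.den⟩

/-- Difference of formal fractions. [folklore] -/
def sub (f g : RatFrac F) : RatFrac F := ⟨f.num * g.den - g.num * f.den, f.den * g.den⟩

/-- Product of formal fractions. [folklore] -/
def mul (f g : RatFrac F) : RatFrac F := ⟨f.num * g.num, f.den * g.den⟩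

/-- Quotient of formal fractions. [folklore] -/
def div (f g : RatFrac F) : RatFrac F := ⟨f.num * g.den, f.den * g.num⟩

variable {f g : RatFrac F} {v : Fin 2 → F} {a b : F}

/-- The value of a fraction is `num(v) / den(v)`. [folklore] -/
theorem HasValue.eq_div (h : f.HasValue v a) :
    a = MvPolynomial.eval v f.num / MvPolynomial.eval v f.den := by
  rw [h.2, mul_div_cancel_right₀ _ h.1]

/-- The denominator of a fraction with a value does not vanish. [folklore] -/
theorem HasValue.den_ne_zero (h : f.HasValue v a) : MvPolynomial.eval v f.den ≠ 0 := h.1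

/-- The value is unique. [folklore] -/
theorem HasValue.unique (h : f.HasValue v a) (h' : f.HasValue v b) : a = b := by
  rw [h.eq_div, h'.eq_div]

/-- Transport of values along an equality. [folklore] -/
theorem HasValue.congr (h : f.HasValue v a) (e : a = b) : f.HasValue v b := e ▸ h

/-- A pair `(P, Q)` with `Q(v) ≠ 0` has the value `P(v) / Q(v)`. [folklore] -/
theorem hasValue_mk {P Q : MvPolynomial (Fin 2) F} (hQ : MvPolynomial.eval v Q ≠ 0) :
    HasValue ⟨P, Q⟩ v (MvPolynomial.eval v P / MvPolynomial.eval v Q) :=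
  ⟨hQ, (div_mul_cancel₀ _ hQ).symm⟩

/-- Value of a constant. [folklore] -/
theorem hasValue_const (c : F) : (const c).HasValue v c := by
  refine ⟨?_, ?_⟩ <;> simp [const]

/-- Value of a sum. [folklore] -/
theorem HasValue.add (hf : f.HasValue v a) (hg : g.HasValue v b) :
    (f.add g).HasValue v (a + b) := by
  refine ⟨?_, ?_⟩
  · simp only [RatFrac.add, map_mul]; exact mul_ne_zero hf.1 hg.1
  · simp only [RatFrac.add, map_add, map_mul, hf.2, hg.2]; ring

/-- Value of a negative. [folklore] -/
theorem HasValue.neg (hf : f.HasValue v a) : f.neg.HasValue v (-a) := by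
  refine ⟨hf.1, ?_⟩
  simp only [RatFrac.neg, map_neg, hf.2]; ring

/-- Value of a difference. [folklore] -/
theorem HasValue.sub (hf : f.HasValue v a) (hg : g.HasValue v b) :
    (f.sub g).HasValue v (a - b) := by
  refine ⟨?_, ?_⟩
  · simp only [RatFrac.sub, map_mul]; exact mul_ne_zero hf.1 hg.1
  · simp only [RatFrac.sub, map_sub, map_mul, hf.2, hg.2]; ring

/-- Value of a product. [folklore] -/
theorem HasValue.mul (hf : f.HasValue v a) (hg : g.HasValue v b) :
    (f.mul g).HasValue v (a * b) := by
  refine ⟨?_, ?_⟩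
  · simp only [RatFrac.mul, map_mul]; exact mul_ne_zero hf.1 hg.1
  · simp only [RatFrac.mul, map_mul, hf.2, hg.2]; ring

/-- Value of a quotient by a fraction with non-zero value. [folklore] -/
theorem HasValue.div (hf : f.HasValue v a) (hg : g.HasValue v b) (hb : b ≠ 0) :
    (f.div g).HasValue v (a / b) := by
  have hgn : MvPolynomial.eval v g.num ≠ 0 := by rw [hg.2]; exact mul_ne_zero hb hg.1
  refine ⟨?_, ?_⟩
  · simp only [RatFrac.div, map_mul]; exact mul_ne_zero hf.1 hgn
  · simp only [RatFrac.div, map_mul, hf.2]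
    rw [hg.2]; field_simp

end RatFrac

/-- **Additive maps agreeing off a finite subset of an infinite group are equal**: the kernel of
their difference has finite complement, hence is everything (the tree's
`Literature.NumberTheory.EllipticCurves.AddSubgroup.eq_top_of_finite_compl` of `DivisionPolynomialTorsion`). [folklore] -/
theorem AddMonoidHom.eq_of_eqOn_compl_finite {G H : Type*} [AddCommGroup G] [Infinite G]
    [AddCommGroup H] {f g : G →+ H} {S : Set G} (hS : S.Finite) (h : ∀ P ∉ S, f P = g P) :
    f = g := by
  have htop : (f - g).ker = ⊤ :=
    Literature.NumberTheory.EllipticCurves.AddSubgroup.eq_top_of_finite_compl _ (hS.subset fun P hP ↦ by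
      by_contra hPS
      exact hP (by rw [SetLike.mem_coe, AddMonoidHom.mem_ker, AddMonoidHom.sub_apply, h P hPS,
        sub_self]))
  ext P
  have hP : P ∈ (f - g).ker := htop ▸ AddSubgroup.mem_top P
  rwa [AddMonoidHom.mem_ker, AddMonoidHom.sub_apply, sub_eq_zero] at hP

end Literature.NumberTheory.EllipticCurves

namespace WeierstrassCurve

open _root_.WeierstrassCurve.geomPoints Literature.NumberTheory.EllipticCurves

variable {K : Type u} [Field K] {W W' : WeierstrassCurve K}

/-- Constructor for `AgreesWithRationalMapAt` from formal-fraction values: if `P` is affine,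
`φ P = (x, y)` and the fractions `P₁/Q₁`, `P₂/Q₂` have the values `x`, `y` at `P`, then `φ`
agrees with `(P₁/Q₁, P₂/Q₂)` at `P`. [folklore] -/
theorem agreesWithRationalMapAt_of_hasValue
    {P₁ Q₁ P₂ Q₂ : MvPolynomial (Fin 2) (AlgebraicClosure K)}
    {φ : W.geomPoints → W'.geomPoints} {P : W.geomPoints} (hP : P ≠ 0)
    {x y : AlgebraicClosure K} {h : (W'.baseChange (AlgebraicClosure K)).toAffine.Nonsingular x y}
    (hφ : φ P = (Affine.Point.some x y h : W'.geomPoints))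
    (hx : RatFrac.HasValue ⟨P₁, Q₁⟩ (xy P) x) (hy : RatFrac.HasValue ⟨P₂, Q₂⟩ (xy P) y) :
    AgreesWithRationalMapAt W W' P₁ Q₁ P₂ Q₂ φ P := by
  rw [agreesWithRationalMapAt_iff]
  refine ⟨hP, hx.1, hy.1, ?_⟩
  have hx' := hx.eq_div
  have hy' := hy.eq_div
  simp only at hx' hy'
  subst hx' hy'
  exact ⟨h, hφ⟩

/-- Destructor for `AgreesWithRationalMapAt` into formal-fraction values. [folklore] -/
theorem AgreesWithRationalMapAt.exists_hasValue
    {P₁ Q₁ P₂ Q₂ : MvPolynomial (Fin 2) (AlgebraicClosure K)}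
    {φ : W.geomPoints → W'.geomPoints} {P : W.geomPoints}
    (hA : AgreesWithRationalMapAt W W' P₁ Q₁ P₂ Q₂ φ P) :
    P ≠ 0 ∧ ∃ (x y : AlgebraicClosure K)
      (h : (W'.baseChange (AlgebraicClosure K)).toAffine.Nonsingular x y),
      φ P = (Affine.Point.some x y h : W'.geomPoints) ∧
        RatFrac.HasValue ⟨P₁, Q₁⟩ (xy P) x ∧ RatFrac.HasValue ⟨P₂, Q₂⟩ (xy P) y := by
  obtain ⟨hP, hQ₁, hQ₂, h', hφ⟩ := agreesWithRationalMapAt_iff.mp hA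
  exact ⟨hP, _, _, h', hφ, RatFrac.hasValue_mk hQ₁, RatFrac.hasValue_mk hQ₂⟩

/-! ## Negatives of algebraic maps -/

/-- The negative of an algebraic map is algebraic: `-(x, y) = (x, -y - a₁x - a₃)`.
Silverman, *AEC*, III.2.3 (group law algorithm). [folklore] -/
theorem IsAlgebraicOn.neg {f : W.geomPoints → W'.geomPoints} (hf : IsAlgebraicOn W W' f) :
    IsAlgebraicOn W W' fun P ↦ -f P := by
  obtain ⟨P₁, Q₁, P₂, Q₂, hfin⟩ := hf
  set A' := (W'.baseChange (AlgebraicClosure K)).toAffine with hA'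
  -- the fraction for the new `y`-coordinate `-y - a₁ x - a₃`
  set X₁ : RatFrac (AlgebraicClosure K) := ⟨P₁, Q₁⟩
  set Y₁ : RatFrac (AlgebraicClosure K) := ⟨P₂, Q₂⟩
  set Yn : RatFrac (AlgebraicClosure K) :=
    ((Y₁.neg).sub ((RatFrac.const A'.a₁).mul X₁)).sub (RatFrac.const A'.a₃) with hYn
  refine ⟨P₁, Q₁, Yn.num, Yn.den, hfin.subset fun P hP hA ↦ hP ?_⟩
  obtain ⟨hP0, x, y, h, hφ, hx, hy⟩ := hA.exists_hasValue
  have hval : Yn.HasValue (xy P) (A'.negY x y) := by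
    exact ((hy.neg).sub ((RatFrac.hasValue_const A'.a₁).mul hx)).sub
      (RatFrac.hasValue_const A'.a₃)
  refine agreesWithRationalMapAt_of_hasValue hP0 (h := (Affine.nonsingular_neg x y).mpr h) ?_
    hx hval
  simp only [hφ]
  rfl

/-! ## Sums of algebraic maps: the chord and tangent cases -/

/-- **Chord case.** Let `f, g : E(K̄) → E'(K̄)` agree with the rational maps `(P₁/Q₁, P₂/Q₂)` and
`(P₁'/Q₁', P₂'/Q₂')`. Off the finite set of points where one of them fails to agree or where
`x(f P) = x(g P)` (i.e. `(P₁Q₁' - P₁'Q₁)(P) = 0`), the sum `f + g` is given by the chord formula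
`x₃ = λ² + a₁λ - a₂ - x₁ - x₂`, `y₃ = -(λ(x₃ - x₁) + y₁) - a₁x₃ - a₃`, `λ = (y₁ - y₂)/(x₁ - x₂)`,
a rational map; so `f + g` is algebraic as soon as that set is finite.
Silverman, *AEC*, III.2.3 (group law algorithm). [folklore] -/
theorem isAlgebraicOn_add_of_finite {f g : W.geomPoints → W'.geomPoints}
    {P₁ Q₁ P₂ Q₂ P₁' Q₁' P₂' Q₂' : MvPolynomial (Fin 2) (AlgebraicClosure K)}
    (hB : {P : W.geomPoints | ¬(AgreesWithRationalMapAt W W' P₁ Q₁ P₂ Q₂ f P ∧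
      AgreesWithRationalMapAt W W' P₁' Q₁' P₂' Q₂' g P ∧
      MvPolynomial.eval (xy P) (P₁ * Q₁' - P₁' * Q₁) ≠ 0)}.Finite) :
    IsAlgebraicOn W W' fun P ↦ f P + g P := by
  set A' := (W'.baseChange (AlgebraicClosure K)).toAffine with hA'
  set X₁ : RatFrac (AlgebraicClosure K) := ⟨P₁, Q₁⟩
  set Y₁ : RatFrac (AlgebraicClosure K) := ⟨P₂, Q₂⟩
  set X₂ : RatFrac (AlgebraicClosure K) := ⟨P₁', Q₁'⟩
  set Y₂ : RatFrac (AlgebraicClosure K) := ⟨P₂', Q₂'⟩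
  set L : RatFrac (AlgebraicClosure K) := (Y₁.sub Y₂).div (X₁.sub X₂)
  set X₃ : RatFrac (AlgebraicClosure K) :=
    ((((L.mul L).add ((RatFrac.const A'.a₁).mul L)).sub (RatFrac.const A'.a₂)).sub X₁).sub X₂
  set nA : RatFrac (AlgebraicClosure K) := (L.mul (X₃.sub X₁)).add Y₁
  set Y₃ : RatFrac (AlgebraicClosure K) :=
    ((nA.neg).sub ((RatFrac.const A'.a₁).mul X₃)).sub (RatFrac.const A'.a₃)
  refine ⟨X₃.num, X₃.den, Y₃.num, Y₃.den, hB.subset fun P hP hgood ↦ hP ?_⟩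
  obtain ⟨hAf, hAg, hne⟩ := hgood
  obtain ⟨hP0, x₁, y₁, h₁, hf, hx₁, hy₁⟩ := hAf.exists_hasValue
  obtain ⟨-, x₂, y₂, h₂, hg, hx₂, hy₂⟩ := hAg.exists_hasValue
  have hx : x₁ ≠ x₂ := by
    intro he
    apply hne
    have e1 := hx₁.2; have e2 := hx₂.2
    simp only at e1 e2
    simp only [map_sub, map_mul, e1, e2, he]
    ring
  set ℓ := (y₁ - y₂) / (x₁ - x₂) with hℓ
  have hL : L.HasValue (xy P) ℓ := (hy₁.sub hy₂).div (hx₁.sub hx₂) (sub_ne_zero.mpr hx)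
  have hX₃ : X₃.HasValue (xy P) (A'.addX x₁ x₂ ℓ) :=
    (((((hL.mul hL).add ((RatFrac.hasValue_const A'.a₁).mul hL)).sub
      (RatFrac.hasValue_const A'.a₂)).sub hx₁).sub hx₂).congr (by simp only [Affine.addX]; ring)
  have hnA : nA.HasValue (xy P) (A'.negAddY x₁ x₂ y₁ ℓ) :=
    ((hL.mul (hX₃.sub hx₁)).add hy₁).congr (by simp only [Affine.negAddY])
  have hY₃ : Y₃.HasValue (xy P) (A'.addY x₁ x₂ y₁ ℓ) :=
    (((hnA.neg).sub ((RatFrac.hasValue_const A'.a₁).mul hX₃)).sub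
      (RatFrac.hasValue_const A'.a₃)).congr (by simp only [Affine.addY, Affine.negY]; try ring)
  have key : ∃ h', f P + g P =
      (Affine.Point.some (A'.addX x₁ x₂ ℓ) (A'.addY x₁ x₂ y₁ ℓ) h' : W'.geomPoints) := by
    have e := Affine.Point.add_of_X_ne (h₁ := h₁) (h₂ := h₂) hx
    simp only [Affine.slope_of_X_ne hx] at e
    exact ⟨_, by rw [hf, hg]; exact e⟩
  obtain ⟨h', hsum⟩ := key
  exact agreesWithRationalMapAt_of_hasValue hP0 hsum hX₃ hY₃

/-- **Tangent case.** Let `f : E(K̄) → E'(K̄)` agree with the rational map `(P₁/Q₁, P₂/Q₂)`. Off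
the finite set of points where it fails to agree or where `2y₁ + a₁x₁ + a₃ = 0` at
`(x₁, y₁) = f P` (i.e. `(2P₂Q₁ + a₁P₁Q₂ + a₃Q₁Q₂)(P) = 0`), the double `f + f` is given by the
tangent formula with `λ = (3x₁² + 2a₂x₁ + a₄ - a₁y₁)/(2y₁ + a₁x₁ + a₃)`, a rational map; so `f + f`
is algebraic as soon as that set is finite. Silverman, *AEC*, III.2.3 (duplication). [folklore] -/
theorem isAlgebraicOn_two_mul_of_finite {f : W.geomPoints → W'.geomPoints}
    {P₁ Q₁ P₂ Q₂ : MvPolynomial (Fin 2) (AlgebraicClosure K)}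
    (hB : {P : W.geomPoints | ¬(AgreesWithRationalMapAt W W' P₁ Q₁ P₂ Q₂ f P ∧
      MvPolynomial.eval (xy P) (2 * P₂ * Q₁ +
        MvPolynomial.C ((W'.baseChange (AlgebraicClosure K)).a₁) * P₁ * Q₂ +
        MvPolynomial.C ((W'.baseChange (AlgebraicClosure K)).a₃) * Q₁ * Q₂) ≠ 0)}.Finite) :
    IsAlgebraicOn W W' fun P ↦ f P + f P := by
  set A' := (W'.baseChange (AlgebraicClosure K)).toAffine with hA'
  set X₁ : RatFrac (AlgebraicClosure K) := ⟨P₁, Q₁⟩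
  set Y₁ : RatFrac (AlgebraicClosure K) := ⟨P₂, Q₂⟩
  set L : RatFrac (AlgebraicClosure K) :=
    (((((RatFrac.const 3).mul (X₁.mul X₁)).add ((RatFrac.const (2 * A'.a₂)).mul X₁)).add
      (RatFrac.const A'.a₄)).sub ((RatFrac.const A'.a₁).mul Y₁)).div
    ((((RatFrac.const 2).mul Y₁).add ((RatFrac.const A'.a₁).mul X₁)).add (RatFrac.const A'.a₃))
  set X₃ : RatFrac (AlgebraicClosure K) :=
    ((((L.mul L).add ((RatFrac.const A'.a₁).mul L)).sub (RatFrac.const A'.a₂)).sub X₁).sub X₁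
  set nA : RatFrac (AlgebraicClosure K) := (L.mul (X₃.sub X₁)).add Y₁
  set Y₃ : RatFrac (AlgebraicClosure K) :=
    ((nA.neg).sub ((RatFrac.const A'.a₁).mul X₃)).sub (RatFrac.const A'.a₃)
  refine ⟨X₃.num, X₃.den, Y₃.num, Y₃.den, hB.subset fun P hP hgood ↦ hP ?_⟩
  obtain ⟨hAf, hne⟩ := hgood
  obtain ⟨hP0, x₁, y₁, h₁, hf, hx₁, hy₁⟩ := hAf.exists_hasValue
  have hy : y₁ ≠ (W'.baseChange (AlgebraicClosure K)).toAffine.negY x₁ y₁ := by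
    intro he
    apply hne
    have e1 := hx₁.2; have e2 := hy₁.2
    simp only at e1 e2
    have he' : 2 * y₁ + A'.a₁ * x₁ + A'.a₃ = 0 := by
      simp only [Affine.negY] at he; linear_combination he
    simp only [map_add, map_mul, MvPolynomial.eval_C, e1, e2, map_ofNat]
    linear_combination (MvPolynomial.eval (xy P) Q₁ * MvPolynomial.eval (xy P) Q₂) * he'
  have hden : 2 * y₁ + A'.a₁ * x₁ + A'.a₃ ≠ 0 := by
    intro he; apply hy; simp only [Affine.negY]; linear_combination he
  set ℓ := (3 * x₁ ^ 2 + 2 * A'.a₂ * x₁ + A'.a₄ - A'.a₁ * y₁) / (y₁ - A'.negY x₁ y₁) with hℓ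
  have hL : L.HasValue (xy P) ℓ := by
    refine ((((((RatFrac.hasValue_const 3).mul (hx₁.mul hx₁)).add
      ((RatFrac.hasValue_const (2 * A'.a₂)).mul hx₁)).add (RatFrac.hasValue_const A'.a₄)).sub
      ((RatFrac.hasValue_const A'.a₁).mul hy₁)).div
      ((((RatFrac.hasValue_const 2).mul hy₁).add ((RatFrac.hasValue_const A'.a₁).mul hx₁)).add
        (RatFrac.hasValue_const A'.a₃)) hden).congr ?_
    rw [hℓ]
    congr 1
    · ring
    · simp only [Affine.negY]; ring
  have hX₃ : X₃.HasValue (xy P) (A'.addX x₁ x₁ ℓ) :=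
    (((((hL.mul hL).add ((RatFrac.hasValue_const A'.a₁).mul hL)).sub
      (RatFrac.hasValue_const A'.a₂)).sub hx₁).sub hx₁).congr (by simp only [Affine.addX]; ring)
  have hnA : nA.HasValue (xy P) (A'.negAddY x₁ x₁ y₁ ℓ) :=
    ((hL.mul (hX₃.sub hx₁)).add hy₁).congr (by simp only [Affine.negAddY])
  have hY₃ : Y₃.HasValue (xy P) (A'.addY x₁ x₁ y₁ ℓ) :=
    (((hnA.neg).sub ((RatFrac.hasValue_const A'.a₁).mul hX₃)).sub
      (RatFrac.hasValue_const A'.a₃)).congr (by simp only [Affine.addY, Affine.negY]; try ring)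
  have key : ∃ h', f P + f P =
      (Affine.Point.some (A'.addX x₁ x₁ ℓ) (A'.addY x₁ x₁ y₁ ℓ) h' : W'.geomPoints) := by
    have e := Affine.Point.add_self_of_Y_ne (h₁ := h₁) hy
    simp only [Affine.slope_of_Y_ne rfl hy] at e
    exact ⟨_, by rw [hf]; exact e⟩
  obtain ⟨h', hsum⟩ := key
  exact agreesWithRationalMapAt_of_hasValue hP0 hsum hX₃ hY₃

/-! ## `Hom_K(E, E')` is a group: sums and negatives of isogenies -/

/-- A polynomial vanishing at infinitely many geometric points vanishes at every affine
geometric point (`eval_eq_zero_of_infinite_zeros` at the coordinates of `P`). [folklore] -/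
theorem eval_xy_eq_zero_of_infinite {g : MvPolynomial (Fin 2) (AlgebraicClosure K)}
    (hg : {P : W.geomPoints | P ≠ 0 ∧ MvPolynomial.eval (xy P) g = 0}.Infinite)
    {P : W.geomPoints} (hP : P ≠ 0) : MvPolynomial.eval (xy P) g = 0 := by
  cases P with
  | zero => exact (hP rfl).elim
  | some x y h => rw [xy_some]; exact eval_eq_zero_of_infinite_zeros hg h.1

/-- **The sum of two isogenies is zero or algebraic** (the heart of "`Hom(E₁, E₂)` is a group").
Let `φ, ψ` agree with rational maps off a finite set `S`. If `x(φP) ≠ x(ψP)` for all but finitely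
many `P`, the chord formula exhibits `φ + ψ` as a rational map (`isAlgebraicOn_add_of_finite`).
Otherwise `x(φP) = x(ψP)` at infinitely many, hence (finitely many zeros,
`eval_eq_zero_of_infinite_zeros`) at all `P ∉ S`, so `φP = ±ψP` off `S`; comparing `y`-coordinates
the same way, either `φ = -ψ` off a finite set, whence `φ + ψ = 0` (additive maps agreeing off a
finite subset of the infinite group `E(K̄)` are equal), or `φ = ψ`, and then `φ + φ` is given by
the tangent formula off the finitely many `P` with `φP ∈ E'[2]` — unless those are infinitely many,
in which case `2φP = O` off `S` and `φ + φ = 0`. Silverman, *AEC*, III.§4 ("(III.3.6) implies that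
`φ + ψ` is a morphism, so it is an isogeny"), with the group law algorithm III.2.3.
[cite: SilvermanAEC2009, III.§4 (Hom(E₁, E₂) is a group)] -/
theorem Isogeny.add_toAddMonoidHom_eq_zero_or_isAlgebraicOn [W.IsElliptic] (φ ψ : Isogeny W W') :
    φ.toAddMonoidHom + ψ.toAddMonoidHom = 0 ∨
      IsAlgebraicOn W W' ⇑(φ.toAddMonoidHom + ψ.toAddMonoidHom) := by
  obtain ⟨P₁, Q₁, P₂, Q₂, hSφ⟩ := φ.isAlgebraic
  obtain ⟨P₁', Q₁', P₂', Q₂', hSψ⟩ := ψ.isAlgebraic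
  set S : Set W.geomPoints := {P | ¬AgreesWithRationalMapAt W W' P₁ Q₁ P₂ Q₂ φ.toAddMonoidHom P} ∪
    {P | ¬AgreesWithRationalMapAt W W' P₁' Q₁' P₂' Q₂' ψ.toAddMonoidHom P} with hS_def
  have hS : S.Finite := hSφ.union hSψ
  have hgood : ∀ P ∉ S, AgreesWithRationalMapAt W W' P₁ Q₁ P₂ Q₂ φ.toAddMonoidHom P ∧
      AgreesWithRationalMapAt W W' P₁' Q₁' P₂' Q₂' ψ.toAddMonoidHom P := fun P hP ↦ by
    simp only [hS_def, Set.mem_union, Set.mem_setOf_eq, not_or, not_not] at hP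
    exact hP
  have hne0 : ∀ P ∉ S, P ≠ 0 := fun P hP ↦ (agreesWithRationalMapAt_iff.mp (hgood P hP).1).1
  -- from an infinite zero set off `S` to vanishing at all `P ∉ S`
  have hall : ∀ g : MvPolynomial (Fin 2) (AlgebraicClosure K),
      ¬{P | P ∉ S ∧ MvPolynomial.eval (xy P) g = 0}.Finite →
        ∀ P ∉ S, MvPolynomial.eval (xy P) g = 0 := fun g hg P hP ↦
    eval_xy_eq_zero_of_infinite (Set.Infinite.mono (fun Q hQ ↦ ⟨hne0 Q hQ.1, hQ.2⟩) hg) (hne0 P hP)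
  -- the finite bad sets of the chord / tangent lemmas
  have hbad : ∀ g : MvPolynomial (Fin 2) (AlgebraicClosure K),
      {P | P ∉ S ∧ MvPolynomial.eval (xy P) g = 0}.Finite →
        {P : W.geomPoints | ¬(AgreesWithRationalMapAt W W' P₁ Q₁ P₂ Q₂ φ.toAddMonoidHom P ∧
          AgreesWithRationalMapAt W W' P₁' Q₁' P₂' Q₂' ψ.toAddMonoidHom P ∧
          MvPolynomial.eval (xy P) g ≠ 0)}.Finite := fun g hg ↦ by
    refine (hS.union hg).subset fun P hP ↦ ?_
    by_cases hPS : P ∈ S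
    · exact Or.inl hPS
    · refine Or.inr ⟨hPS, ?_⟩
      by_contra hne
      exact hP ⟨(hgood P hPS).1, (hgood P hPS).2, hne⟩
  by_cases hZ : {P | P ∉ S ∧ MvPolynomial.eval (xy P) (P₁ * Q₁' - P₁' * Q₁) = 0}.Finite
  · -- Case 1: the chord formula off a finite set
    exact Or.inr (isAlgebraicOn_add_of_finite (hbad _ hZ))
  -- Case 2: `x(φ P) = x(ψ P)` for all `P ∉ S`
  have hx := hall _ hZ
  have hdec : ∀ P ∉ S, ∃ (x₁ y₁ y₂ : AlgebraicClosure K)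
      (h₁ : (W'.baseChange (AlgebraicClosure K)).toAffine.Nonsingular x₁ y₁)
      (h₂ : (W'.baseChange (AlgebraicClosure K)).toAffine.Nonsingular x₁ y₂),
      φ.toAddMonoidHom P = (Affine.Point.some x₁ y₁ h₁ : W'.geomPoints) ∧
      ψ.toAddMonoidHom P = (Affine.Point.some x₁ y₂ h₂ : W'.geomPoints) ∧
      RatFrac.HasValue ⟨P₁, Q₁⟩ (xy P) x₁ ∧ RatFrac.HasValue ⟨P₂, Q₂⟩ (xy P) y₁ ∧
      RatFrac.HasValue ⟨P₂', Q₂'⟩ (xy P) y₂ := by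
    intro P hPS
    obtain ⟨hAφ, hAψ⟩ := hgood P hPS
    obtain ⟨hP0, x₁, y₁, h₁, hf, hx₁, hy₁⟩ := hAφ.exists_hasValue
    obtain ⟨-, x₂, y₂, h₂, hg, hx₂, hy₂⟩ := hAψ.exists_hasValue
    have hxx : x₁ = x₂ := by
      have e := hx P hPS
      have e1 := hx₁.2; have e2 := hx₂.2; simp only at e1 e2
      simp only [map_sub, map_mul, e1, e2] at e
      have h3 : (x₁ - x₂) * (MvPolynomial.eval (xy P) Q₁ * MvPolynomial.eval (xy P) Q₁') = 0 := by
        linear_combination e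
      exact sub_eq_zero.mp ((mul_eq_zero.mp h3).resolve_right (mul_ne_zero hx₁.1 hx₂.1))
    subst hxx
    exact ⟨x₁, y₁, y₂, h₁, h₂, hf, hg, hx₁, hy₁, hy₂⟩
  by_cases hZ₂ : {P | P ∉ S ∧ MvPolynomial.eval (xy P) (P₂ * Q₂' - P₂' * Q₂) = 0}.Finite
  · -- `φ P = -ψ P` off the finite set `S ∪ Z₂`, so `φ + ψ = 0`
    refine Or.inl (Literature.NumberTheory.EllipticCurves.AddMonoidHom.eq_of_eqOn_compl_finite (hS.union hZ₂) fun P hP ↦ ?_)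
    simp only [Set.mem_union, Set.mem_setOf_eq, not_or, not_and] at hP
    obtain ⟨hPS, hP2⟩ := hP
    obtain ⟨x₁, y₁, y₂, h₁, h₂, hf, hg, hx₁, hy₁, hy₂⟩ := hdec P hPS
    have hyy : y₁ ≠ y₂ := by
      intro he
      apply hP2 hPS
      have e1 := hy₁.2; have e2 := hy₂.2; simp only at e1 e2
      simp only [map_sub, map_mul, e1, e2, he]
      ring
    have hneg : y₁ = (W'.baseChange (AlgebraicClosure K)).toAffine.negY x₁ y₂ :=
      (Affine.Y_eq_of_X_eq h₁.1 h₂.1 rfl).resolve_left hyy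
    rw [AddMonoidHom.add_apply, AddMonoidHom.zero_apply, hf, hg]
    exact Affine.Point.add_of_Y_eq rfl hneg
  -- `φ = ψ` off `S`, hence everywhere
  have hy := hall _ hZ₂
  have heq : φ.toAddMonoidHom = ψ.toAddMonoidHom := by
    refine Literature.NumberTheory.EllipticCurves.AddMonoidHom.eq_of_eqOn_compl_finite hS fun P hPS ↦ ?_
    obtain ⟨x₁, y₁, y₂, h₁, h₂, hf, hg, hx₁, hy₁, hy₂⟩ := hdec P hPS
    have hyy : y₁ = y₂ := by
      have e := hy P hPS
      have e1 := hy₁.2; have e2 := hy₂.2; simp only at e1 e2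
      simp only [map_sub, map_mul, e1, e2] at e
      have h3 : (y₁ - y₂) * (MvPolynomial.eval (xy P) Q₂ * MvPolynomial.eval (xy P) Q₂') = 0 := by
        linear_combination e
      exact sub_eq_zero.mp ((mul_eq_zero.mp h3).resolve_right (mul_ne_zero hy₁.1 hy₂.1))
    subst hyy
    rw [hf, hg]
  rw [← heq]
  -- doubling: tangent formula off the points with `φ P ∈ E'[2]`
  set gd : MvPolynomial (Fin 2) (AlgebraicClosure K) := 2 * P₂ * Q₁ +
    MvPolynomial.C ((W'.baseChange (AlgebraicClosure K)).a₁) * P₁ * Q₂ +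
    MvPolynomial.C ((W'.baseChange (AlgebraicClosure K)).a₃) * Q₁ * Q₂ with hgd
  by_cases hZ₃ : {P | P ∉ S ∧ MvPolynomial.eval (xy P) gd = 0}.Finite
  · refine Or.inr (isAlgebraicOn_two_mul_of_finite (P₁ := P₁) (Q₁ := Q₁) (P₂ := P₂) (Q₂ := Q₂)
      ((hbad gd hZ₃).subset fun P hP hP' ↦ hP ⟨hP'.1, hP'.2.2⟩))
  -- `2 φ P = O` off `S`, so `φ + φ = 0`
  have hd := hall _ hZ₃
  refine Or.inl (Literature.NumberTheory.EllipticCurves.AddMonoidHom.eq_of_eqOn_compl_finite hS fun P hPS ↦ ?_)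
  obtain ⟨x₁, y₁, y₂, h₁, h₂, hf, -, hx₁, hy₁, -⟩ := hdec P hPS
  have hyy : y₁ = (W'.baseChange (AlgebraicClosure K)).toAffine.negY x₁ y₁ := by
    have e := hd P hPS
    have e1 := hx₁.2; have e2 := hy₁.2; simp only at e1 e2
    simp only [hgd, map_add, map_mul, MvPolynomial.eval_C, e1, e2, map_ofNat] at e
    have h3 : (2 * y₁ + (W'.baseChange (AlgebraicClosure K)).a₁ * x₁ +
        (W'.baseChange (AlgebraicClosure K)).a₃) *
        (MvPolynomial.eval (xy P) Q₁ * MvPolynomial.eval (xy P) Q₂) = 0 := by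
      linear_combination e
    have h4 := (mul_eq_zero.mp h3).resolve_right (mul_ne_zero hx₁.1 hy₁.1)
    simp only [Affine.negY]
    linear_combination h4
  rw [AddMonoidHom.add_apply, AddMonoidHom.zero_apply, hf]
  exact Affine.Point.add_self_of_Y_eq hyy

/-- **The sum of two isogenies over `K` is zero or an isogeny over `K`.**
Silverman, *AEC*, III.§4. [cite: SilvermanAEC2009, III.§4 (Hom(E₁, E₂) is a group)] -/
theorem Isogeny.add_toAddMonoidHom_eq_zero_or_exists [W.IsElliptic] (φ ψ : Isogeny W W') :
    φ.toAddMonoidHom + ψ.toAddMonoidHom = 0 ∨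
      ∃ χ : Isogeny W W', χ.toAddMonoidHom = φ.toAddMonoidHom + ψ.toAddMonoidHom := by
  rcases φ.add_toAddMonoidHom_eq_zero_or_isAlgebraicOn ψ with h | h
  · exact Or.inl h
  · refine Or.inr ⟨⟨φ.toAddMonoidHom + ψ.toAddMonoidHom, h, fun σ P ↦ ?_, h.finite_ker⟩, rfl⟩
    simp only [AddMonoidHom.add_apply, Isogeny.coe_toAddMonoidHom, Isogeny.map_smul, smul_add]

/-- **The negative of an isogeny over `K` is an isogeny over `K`.**
Silverman, *AEC*, III.§4. [cite: SilvermanAEC2009, III.§4 (Hom(E₁, E₂) is a group)] -/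
theorem Isogeny.exists_toAddMonoidHom_eq_neg (φ : Isogeny W W') :
    ∃ χ : Isogeny W W', χ.toAddMonoidHom = -φ.toAddMonoidHom :=
  ⟨⟨-φ.toAddMonoidHom, φ.isAlgebraic.neg, fun σ P ↦ by
    simp only [AddMonoidHom.neg_apply, Isogeny.coe_toAddMonoidHom, Isogeny.map_smul, smul_neg],
    IsAlgebraicOn.finite_ker (f := -φ.toAddMonoidHom) φ.isAlgebraic.neg⟩, rfl⟩

variable (W W') in
/-- **`Hom_K(E, E')` is a group** — discharge of the named fact `mem_homModule_iff W W'`: an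
additive map `E(K̄) → E'(K̄)` lies in the `ℤ`-span of the isogenies over `K` iff it is `0` or an
isogeny over `K`, because `{0} ∪ {isogenies}` is closed under sums
(`Isogeny.add_toAddMonoidHom_eq_zero_or_exists`) and negatives
(`Isogeny.exists_toAddMonoidHom_eq_neg`). Silverman, *AEC*, III.§4, the paragraph introducing
`Hom(E₁, E₂)`. [cite: SilvermanAEC2009, III.§4 (Hom(E₁, E₂) is a group)] -/
theorem mem_homModule_iff_holds : mem_homModule_iff W W' := by
  intro _ _ f
  refine ⟨fun hf ↦ ?_, mem_homModule_of_eq_zero_or_exists⟩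
  let T : AddSubgroup (W.geomPoints →+ W'.geomPoints) :=
    { carrier := {f | f = 0 ∨ ∃ φ : Isogeny W W', φ.toAddMonoidHom = f}
      zero_mem' := Or.inl rfl
      add_mem' := by
        rintro f g (rfl | ⟨φ, rfl⟩) (rfl | ⟨ψ, rfl⟩)
        · exact Or.inl (add_zero 0)
        · exact Or.inr ⟨ψ, (zero_add _).symm⟩
        · exact Or.inr ⟨φ, (add_zero _).symm⟩
        · exact φ.add_toAddMonoidHom_eq_zero_or_exists ψ
      neg_mem' := by
        rintro f (rfl | ⟨φ, rfl⟩)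
        · exact Or.inl neg_zero
        · exact Or.inr φ.exists_toAddMonoidHom_eq_neg }
  have hle : homModule W W' ≤ T.toIntSubmodule :=
    Submodule.span_le.mpr (by rintro _ ⟨φ, rfl⟩; exact Or.inr ⟨φ, rfl⟩)
  exact hle hf

end WeierstrassCurve
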